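import Summits.CriticalPhenomena.CardyFormulaZ2.Theorems.CardyBoundaryCoulombGasHalfPlaneMarkDensityLawDenseDerivPos
import Summits.CriticalPhenomena.CardyFormulaZ2.Theorems.CardyBoundaryCoulombGasHalfPlaneMarkDensityLawDenseDeriv4
import Summits.CriticalPhenomena.CardyFormulaZ2.Theorems.CardyBoundaryCoulombGasHalfPlaneMarkDensityLawDenseLawSeqGe
import Summits.CriticalPhenomena.CardyFormulaZ2.Theorems.CardyBoundaryCoulombGasHalfPlaneMarkDensityLawDenseLawSeqNear
import Summits.CriticalPhenomena.CardyFormulaZ2.Theorems.CardyBoundaryCoulombGasHalfPlaneMarkDensityLawDenseDeriv2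

/-!
# `HalfPlaneMarkDensityLaw` (crux stmt-CriticalPhenomena-5661), line `Sketch`, cycle 3 (`DensePos`), lead c12-0:
# assembly — **the subsequential density limits are positive on an open dense set of marks**

`P_n(a,b,c,y) = P_{1/2}[[⌊an⌋,⌊bn⌋]×{0} ↔ [⌊cn⌋,⌊yn⌋]×{0} in ℤ×ℕ]`, `lawSeq a b c x n = n · P[E_n(a,b,c,x)]` the
crux's sequence.  For every joint subsequential limit `G` along a strictly increasing `θ` (they exist along
a subsequence of every subsequence, c2-0), `y ↦ G(a,b,c,y)` is `C¹` on `(c,∞)` with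
`lawSeq a b c x (θ j) → ∂₄G(a,b,c,x)` (c4-0) and STRICTLY increasing (this seat, `stub_jointLimit_strictMono`);
a strictly monotone differentiable function has nonzero derivative on a dense set (`stub_deriv_pos_dense`,
mean value theorem).  Composition of the landed stubs of `Lines/Sketch_DensePos.lean`:

* `stub_deriv4_pos_openDense` — `{x > c : ∂₄G(a,b,c,x) > 0}` is OPEN and DENSE in `(c,∞)`: along `θ` the
  crux's density law holds in the weak sense "positive finite limit" for an open dense set of fourth marks
  (the registered positivity stub `stub_densityPositivity` asks positivity at every mark along the full
  sequence — that needs arm separation and stays open);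
* `stub_deriv2_pos_dense` — likewise `∂₂G > 0` on a dense subset of `(a,c)`;
* `stub_lawSeq_frequently_ge_near` — subsequence-free: for `a < b < c < x₀` and `ε > 0` there is a fourth
  mark `x`, `|x − x₀| < ε`, with `n · P[E_n(a,b,c,x)] ≥ c₁(x) > 0` for infinitely many `n`.
-/

noncomputable section

namespace Summit.CriticalPhenomena.CardyFormulaZ2.Cruxes.HalfPlaneMarkDensityLaw.SketchLine

open Literature.Probability.Percolation Literature.Probability.LatticeModels
open MeasureTheory Filter Set
open scoped Topology
open Summit.CriticalPhenomena.CardyFormulaZ2.Theorems.HalfPlaneMarkDensityLaw.Negative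

namespace DensePos

/-- **`∂₄G > 0` on an open dense subset of `(c,∞)`**, for every joint subsequential scaling limit `G` of the
half-plane four-arc crossing probability of critical bond-`ℤ²` and all `a < b < c`. [folklore] -/
theorem stub_deriv4_pos_openDense :
    ∀ {θ : ℕ → ℕ} {G : ℝ → ℝ → ℝ → ℝ → ℝ}, (∀ a b c y : ℝ, a < b → b < c → c < y → Tendsto (fun n ↦ μ.real (openCrossing halfPlane (arcA a b (θ n)) (rowIcc ⌊c * (θ n : ℕ)⌋ ⌊y * (θ n : ℕ)⌋))) atTop (𝓝 (G a b c y))) → StrictMono θ → ∀ {a b c : ℝ}, a < b → b < c → IsOpen {x | c < x ∧ 0 < deriv (G a b c) x} ∧ Ioi c ⊆ closure {x | c < x ∧ 0 < deriv (G a b c) x} :=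
  stub_deriv4_pos_openDense_of stub_deriv_pos_dense

/-- **Near every fourth mark the lattice mark density is frequently bounded below**: for `a < b < c < x₀`
and `ε > 0` there are `x` with `|x − x₀| < ε`, `c < x`, and `c₁ > 0` with `c₁ ≤ n · P[E_n(a,b,c,x)]` for
infinitely many `n`. [folklore] -/
theorem stub_lawSeq_frequently_ge_near :
    ∀ (a b c x₀ ε : ℝ), a < b → b < c → c < x₀ → 0 < ε → ∃ x : ℝ, |x - x₀| < ε ∧ c < x ∧ ∃ c₁ : ℝ, 0 < c₁ ∧ ∃ᶠ n : ℕ in atTop, c₁ ≤ lawSeq a b c x n :=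
  stub_lawSeq_frequently_ge_near_of stub_deriv4_pos_openDense stub_lawSeq_eventually_ge

/-- **`∂₂G > 0` on a dense subset of `(a,c)`** (`c < y`), for every joint subsequential limit. [folklore] -/
theorem stub_deriv2_pos_dense :
    ∀ {θ : ℕ → ℕ} {G : ℝ → ℝ → ℝ → ℝ → ℝ}, (∀ a b c y : ℝ, a < b → b < c → c < y → Tendsto (fun n ↦ μ.real (openCrossing halfPlane (arcA a b (θ n)) (rowIcc ⌊c * (θ n : ℕ)⌋ ⌊y * (θ n : ℕ)⌋))) atTop (𝓝 (G a b c y))) → StrictMono θ → ∀ {a c y : ℝ}, a < c → c < y → Ioo a c ⊆ closure {s | a < s ∧ s < c ∧ 0 < deriv (fun s ↦ G a s c y) s} :=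
  stub_deriv2_pos_dense_of stub_deriv_pos_dense_Ioo

end DensePos

end Summit.CriticalPhenomena.CardyFormulaZ2.Cruxes.HalfPlaneMarkDensityLaw.SketchLine
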